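import Summits.QuantumAdvantage.QuantumAdvantage.Theorems.SymplecticPurityCubeGraphFlat
import Summits.QuantumAdvantage.QuantumAdvantage.Theorems.SymplecticPurityGraphStateSpectrum

/-!
# Crux `DeqThesis` (stmt-QuantumAdvantage-0242), line `Sketch` — stub `stub_oneSidedFlat`, lemmas

Bookkeeping for the one-sided flatness estimate of the normalised cube graph state
`ĝ = (√2ⁿ)⁻¹ Σ_x |x⟩|e((e⁻¹x)³)⟩` against locally rotated Pauli strings `⊗ₖ uₖ σ_{Sₖ} uₖ†`
(file `SymplecticPurityDeqThesisOneSidedFlat.lean`):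

* one-site facts: a `2 × 2` unitary `M` has `|M(a,b)|` depending only on `a ⊕ b`
  (`norm_entry_of_unitary`), with `c² + s² = 1` and `c + s ≤ √2`; the rotated letter `u σ_Q u†` is
  unitary, equals `1` for `Q = I`, and is traceless for `Q ≠ I` (`Tr(u σ u†) = Tr σ = 0`), so its
  diagonal entries are `M(0,0)·(−1)^{[Q≠I] b}` (`conj_apply_diag`);
* `graph_dot_tensorAll_mulVec` — `⟨g| ⊗N |g⟩ = c̄ c Σ_{x,x'} A(x,x') B(f x, f x')` for a weighted graph
  vector `g = c Σ_x |x⟩|f x⟩` (`sum_graph_indicator` twice, `Fin.prod_univ_add`);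
* `card_filter_cube_xor_le_two` — almost perfect nonlinearity of `x ↦ x³` in register coordinates
  (transport through `e` to `card_filter_cube_diff_le_two`), and `abs_sum_sign_cube_le` — the Walsh
  bound `|Σ_x (−1)^{mA·x + mB·F(x)}| ≤ 2 √2ⁿ` for masks not both zero (`abs_walsh_cube_le`,
  `sum_sign_eq_zero`);
* `norm_double_sum_le` — pairing by the input difference `x' = x ⊕ d`: if `|A(x,x')| ≤ w_A(x ⊕ x')`,
  `|B(y,y')| ≤ w_B(y ⊕ y')` and every non-trivial differential of `F` is at most two-to-one, then
  `|Σ_{x,x'} A(x,x') B(Fx,Fx')| ≤ D + 2 (Σ_d w_A d)(Σ_t w_B t)` with `D` a bound for the diagonal.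
-/

set_option linter.dupNamespace false -- D-0017: single-problem summit ⇒ `QuantumAdvantage.QuantumAdvantage` by design

namespace Summit.QuantumAdvantage.QuantumAdvantage.Theorems.SymplecticPurity

open Matrix Finset Literature.Computability.QuantumComplexity Literature.Computability.Cryptography

namespace OneSided

/-! ### One-qubit facts: entries of a `2 × 2` unitary, rotated Pauli letters -/

/-- Rows of a `2 × 2` unitary are unit vectors. -/
theorem norm_sq_row_of_unitary {M : Matrix Bool Bool ℂ} (hM : M ∈ Matrix.unitaryGroup Bool ℂ)
    (a : Bool) : ‖M a true‖ ^ 2 + ‖M a false‖ ^ 2 = 1 := by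
  have h := congrFun (congrFun (Matrix.mem_unitaryGroup_iff.1 hM) a) a
  rw [Matrix.mul_apply, Fintype.sum_bool, Matrix.one_apply_eq] at h
  simp only [Matrix.star_apply, RCLike.star_def, Complex.mul_conj'] at h
  exact_mod_cast h

/-- Columns of a `2 × 2` unitary are unit vectors. -/
theorem norm_sq_col_of_unitary {M : Matrix Bool Bool ℂ} (hM : M ∈ Matrix.unitaryGroup Bool ℂ)
    (a : Bool) : ‖M true a‖ ^ 2 + ‖M false a‖ ^ 2 = 1 := by
  have h := congrFun (congrFun (Matrix.mem_unitaryGroup_iff'.1 hM) a) a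
  rw [Matrix.mul_apply, Fintype.sum_bool, Matrix.one_apply_eq] at h
  simp only [Matrix.star_apply, RCLike.star_def, Complex.conj_mul'] at h
  exact_mod_cast h

/-- The moduli of the entries of a `2 × 2` unitary depend only on `a ⊕ b`. -/
theorem norm_entry_of_unitary {M : Matrix Bool Bool ℂ} (hM : M ∈ Matrix.unitaryGroup Bool ℂ)
    (a b : Bool) : ‖M a b‖ = if Bool.xor a b then ‖M false true‖ else ‖M false false‖ := by
  have r0 := norm_sq_row_of_unitary hM false
  have r1 := norm_sq_row_of_unitary hM true
  have c0 := norm_sq_col_of_unitary hM false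
  cases a <;> cases b
  · simp
  · simp
  · have h : ‖M true false‖ ^ 2 = ‖M false true‖ ^ 2 := by linarith
    simpa using (sq_eq_sq₀ (norm_nonneg _) (norm_nonneg _)).1 h
  · have h : ‖M true true‖ ^ 2 = ‖M false false‖ ^ 2 := by linarith
    simpa using (sq_eq_sq₀ (norm_nonneg _) (norm_nonneg _)).1 h

/-- `c + s ≤ √2` for the two moduli `c, s` (`c² + s² = 1`) of a `2 × 2` unitary. -/
theorem norm_add_norm_le_sqrt_two {M : Matrix Bool Bool ℂ} (hM : M ∈ Matrix.unitaryGroup Bool ℂ) :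
    ‖M false false‖ + ‖M false true‖ ≤ Real.sqrt 2 := by
  have r0 := norm_sq_row_of_unitary hM false
  have hnn : 0 ≤ ‖M false false‖ + ‖M false true‖ := by positivity
  have hsq : (‖M false false‖ + ‖M false true‖) ^ 2 ≤ 2 := by
    nlinarith [sq_nonneg (‖M false false‖ - ‖M false true‖)]
  calc ‖M false false‖ + ‖M false true‖ = Real.sqrt ((‖M false false‖ + ‖M false true‖) ^ 2) :=
        (Real.sqrt_sq hnn).symm
    _ ≤ Real.sqrt 2 := Real.sqrt_le_sqrt hsq

/-- A locally rotated Pauli letter `v σ_Q v†` is unitary. -/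
theorem conj_mem_unitaryGroup {v : Matrix Bool Bool ℂ} (hv : v ∈ Matrix.unitaryGroup Bool ℂ)
    (Q : Pauli) : v * Q.mat * star v ∈ Matrix.unitaryGroup Bool ℂ :=
  Submonoid.mul_mem _ (Submonoid.mul_mem _ hv (show Q.mat ∈ Matrix.unitaryGroup Bool ℂ by
    rw [Matrix.mem_unitaryGroup_iff, Matrix.star_eq_conjTranspose, Pauli.conjTranspose_mat, Pauli.mat_mul_self])) (Unitary.star_mem hv)

/-- For the identity letter the rotated factor is `1`. -/
theorem conj_I_eq_one {v : Matrix Bool Bool ℂ} (hv : v ∈ Matrix.unitaryGroup Bool ℂ) :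
    v * Pauli.I.mat * star v = 1 := by
  rw [show Pauli.I.mat = 1 from rfl, mul_one, Matrix.mem_unitaryGroup_iff.1 hv]

/-- For a non-identity letter the rotated factor is traceless: `M₁₁ = -M₀₀`. -/
theorem conj_apply_true_true {v : Matrix Bool Bool ℂ} (hv : v ∈ Matrix.unitaryGroup Bool ℂ)
    {Q : Pauli} (hQ : Q ≠ Pauli.I) :
    (v * Q.mat * star v) true true = -(v * Q.mat * star v) false false := by
  have htr : (v * Q.mat * star v).trace = 0 := by
    rw [Matrix.trace_mul_cycle, Matrix.mem_unitaryGroup_iff'.1 hv, one_mul, Matrix.trace,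
      Fintype.sum_bool, Matrix.diag_apply, Matrix.diag_apply]
    cases Q <;> simp_all
  rw [Matrix.trace, Fintype.sum_bool, Matrix.diag_apply, Matrix.diag_apply] at htr
  exact eq_neg_of_add_eq_zero_left htr

/-- Diagonal entries of a rotated letter as signs: `M_{bb} = M₀₀ · (−1)^{[Q ≠ I]·b}`. -/
theorem conj_apply_diag {v : Matrix Bool Bool ℂ} (hv : v ∈ Matrix.unitaryGroup Bool ℂ)
    (Q : Pauli) (b : Bool) :
    (v * Q.mat * star v) b b = (v * Q.mat * star v) false false *
      ((if (if Q = Pauli.I then (0 : ZMod 2) else 1) * (if b then (1 : ZMod 2) else 0) = 0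
        then (1 : ℝ) else -1 : ℝ) : ℂ) := by
  have h10 : (1 : ZMod 2) ≠ 0 := by decide
  cases b
  · simp
  · by_cases hQ : Q = Pauli.I
    · subst hQ
      simp [conj_I_eq_one hv]
    · rw [conj_apply_true_true hv hQ]
      simp [hQ, h10]

/-- For the identity letter the two moduli are `(c, s) = (1, 0)`. -/
theorem norm_conj_I {v : Matrix Bool Bool ℂ} (hv : v ∈ Matrix.unitaryGroup Bool ℂ) :
    ‖(v * Pauli.I.mat * star v) false false‖ = 1 ∧ ‖(v * Pauli.I.mat * star v) false true‖ = 0 := by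
  rw [conj_I_eq_one hv]
  simp

/-! ### Tensor bookkeeping -/

/-- Norm of an entry of a tensor product of `2 × 2` unitaries: a product weight of the difference
pattern `x ⊕ x'`. -/
theorem norm_prod_entry {m : ℕ} (N : Fin m → Matrix Bool Bool ℂ)
    (hN : ∀ k, N k ∈ Matrix.unitaryGroup Bool ℂ) (x x' : Fin m → Bool) :
    ‖∏ k, N k (x k) (x' k)‖ =
      ∏ k, (if Bool.xor (x k) (x' k) then ‖N k false true‖ else ‖N k false false‖) := by
  rw [norm_prod]
  exact Finset.prod_congr rfl fun k _ => norm_entry_of_unitary (hN k) _ _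

/-- Total mass of a product weight: `Σ_d ∏_k w_k(d_k) = ∏_k (c_k + s_k)`. -/
theorem sum_weight_eq_prod {m : ℕ} (c s : Fin m → ℝ) :
    ∑ d : Fin m → Bool, ∏ k, (if d k then s k else c k) = ∏ k, (c k + s k) := by
  rw [← Fintype.prod_sum fun k (b : Bool) => if b then s k else c k]
  refine Finset.prod_congr rfl fun k _ => ?_
  rw [Fintype.sum_bool]
  simp [add_comm]

/-- A product of factors `≤ √2`, equal to at most `1` off `I`, is at most `√2 ^ |I|`. -/
theorem prod_le_sqrt_two_pow {m : ℕ} (f : Fin m → ℝ) (I : Finset (Fin m))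
    (hnn : ∀ k, 0 ≤ f k) (h1 : ∀ k, f k ≤ Real.sqrt 2) (h0 : ∀ k, k ∉ I → f k ≤ 1) :
    ∏ k, f k ≤ Real.sqrt 2 ^ I.card := by
  classical
  calc ∏ k, f k ≤ ∏ k, (if k ∈ I then Real.sqrt 2 else 1) :=
        Finset.prod_le_prod (fun k _ => hnn k) fun k _ => by
          split_ifs with hk
          · exact h1 k
          · exact h0 k hk
    _ = Real.sqrt 2 ^ I.card := by
        rw [Finset.prod_ite, Finset.prod_const, Finset.prod_const_one, mul_one,
          Finset.filter_mem_eq_inter, Finset.univ_inter]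

/-- `a ⊕ (a ⊕ b) = b`. -/
theorem xor_xor_cancel (a b : Bool) : Bool.xor a (Bool.xor a b) = b := by
  cases a <;> cases b <;> rfl

/-- **Expectation of a product operator in a weighted graph vector.** For
`g = c · Σ_x |x⟩|f x⟩` and `N = ⊗ₖ Nₖ` on `n + n` wires,
`⟨g| N |g⟩ = c̄ c Σ_{x, x'} (∏_i N_i (x_i, x'_i)) (∏_j N_{n+j} ((f x)_j, (f x')_j))`. -/
theorem graph_dot_tensorAll_mulVec {n : ℕ} (f : QReg n → QReg n)
    (N : Fin (n + n) → Matrix Bool Bool ℂ) (c : ℂ) (g : QReg (n + n) → ℂ)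
    (hg : g = fun w => if (fun j : Fin n => w (Fin.natAdd n j)) = f (fun i : Fin n => w (Fin.castAdd n i))
      then c else 0) :
    star g ⬝ᵥ (tensorAll N).mulVec g =
      star c * c * ∑ x : QReg n, ∑ x' : QReg n,
        (∏ i : Fin n, N (Fin.castAdd n i) (x i) (x' i)) *
          ∏ j : Fin n, N (Fin.natAdd n j) (f x j) (f x' j) := by
  have hs : ∀ (p : Prop) [Decidable p] (X : ℂ),
      star (if p then c else 0) * X = if p then star c * X else 0 := by
    intro p _ X
    split_ifs <;> simp
  have ht : ∀ (p : Prop) [Decidable p] (X : ℂ),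
      X * (if p then c else 0) = if p then X * c else 0 := by
    intro p _ X
    split_ifs <;> simp
  have hin : ∀ w : QReg (n + n),
      (∑ w' : QReg (n + n), if (fun j : Fin n => w' (Fin.natAdd n j)) = f (fun i : Fin n => w' (Fin.castAdd n i))
        then tensorAll N w w' * c else 0) = ∑ x' : QReg n, tensorAll N w (Fin.append x' (f x')) * c :=
    fun w => sum_graph_indicator f (fun w' => tensorAll N w w' * c)
  subst hg
  simp only [dotProduct, Matrix.mulVec_apply_eq_sum, Pi.star_apply, hs, ht, hin]
  rw [sum_graph_indicator f, Finset.mul_sum]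
  refine Finset.sum_congr rfl fun x _ => ?_
  rw [Finset.mul_sum, Finset.mul_sum]
  refine Finset.sum_congr rfl fun x' _ => ?_
  rw [tensorAll_apply, Fin.prod_univ_add]
  simp only [Fin.append_left, Fin.append_right]
  ring

/-! ### The cube S-box: differential and Walsh estimates in register coordinates -/

/-- Bit bookkeeping: if `[z₁ = 1] ⊕ [z₂ = 1] = b` then `z₂ + z₁` is the bit `b`. -/
theorem xor_decide_eq_bit (z₁ z₂ : ZMod 2) (b : Bool)
    (h : Bool.xor (decide (z₁ = 1)) (decide (z₂ = 1)) = b) : z₂ + z₁ = if b then 1 else 0 := by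
  revert z₁ z₂ b h
  decide

/-- **Almost perfect nonlinearity of the cube, in coordinates**: for a non-zero input difference
`d`, every output difference `t` of `F = e ∘ (·)³ ∘ e⁻¹` is attained by at most two inputs `x`
(they inject, via `x ↦ e⁻¹ x`, into the solutions of `(v + α)³ + v³ = β`, `α = e⁻¹ d ≠ 0`). -/
theorem card_filter_cube_xor_le_two {n : ℕ} {K : Type*} [Field K] [Fintype K]
    (hK : Fintype.card K = 2 ^ n) (e : K ≃+ (Fin n → ZMod 2)) (F : QReg n → QReg n)
    (hF : ∀ x j, F x j = decide (e ((e.symm fun i : Fin n => if x i then 1 else 0) ^ 3) j = 1))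
    (d : QReg n) (hd : d ≠ fun _ => false) (t : QReg n) :
    (Finset.univ.filter fun x : QReg n =>
      (fun j : Fin n => Bool.xor (F x j) (F (fun i => Bool.xor (x i) (d i)) j)) = t).card ≤ 2 := by
  classical
  have h10 : (1 : ZMod 2) ≠ 0 := by decide
  set α : K := e.symm fun i : Fin n => if d i then 1 else 0 with hα
  set β : K := e.symm fun j : Fin n => if t j then 1 else 0 with hβ
  have hα0 : α ≠ 0 := by
    intro h0
    apply hd
    funext i
    have h1 := congrFun (congrArg e h0) i
    rw [hα, AddEquiv.apply_symm_apply, map_zero, Pi.zero_apply] at h1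
    cases hdi : d i
    · rfl
    · rw [hdi, if_pos rfl] at h1
      exact absurd h1 h10
  refine le_trans (Finset.card_le_card_of_injOn
    (fun x : QReg n => e.symm fun i : Fin n => if x i then 1 else 0) ?_ ?_)
    (card_filter_cube_diff_le_two (two_eq_zero_of_card hK) α β (Or.inl hα0))
  · intro x hx
    rw [Finset.mem_coe, Finset.mem_filter] at hx ⊢
    refine ⟨Finset.mem_univ _, ?_⟩
    apply e.injective
    rw [map_add, hβ, AddEquiv.apply_symm_apply]
    funext j
    rw [Pi.add_apply]
    have hj := congrFun hx.2 j
    simp only [hF] at hj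
    rw [bits_xor, map_add, ← hα] at hj
    exact xor_decide_eq_bit _ _ _ hj
  · intro x₁ _ x₂ _ h
    exact bits_injective (e.symm.injective h)

/-- **Near-bentness of the cube, in coordinates**: for masks `mA, mB : Fin n → ZMod 2`, not both
zero, `|Σ_x (−1)^{mA·x + mB·F(x)}| ≤ 2 √2ⁿ` — transported through `e` this is the Walsh sum of two
additive functionals `φ, ψ` of `K` (`abs_walsh_cube_le` if `ψ ≠ 0`, `sum_sign_eq_zero` if
`ψ = 0 ≠ φ`). -/
theorem abs_sum_sign_cube_le {n : ℕ} {K : Type*} [Field K] [Fintype K]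
    (hK : Fintype.card K = 2 ^ n) (e : K ≃+ (Fin n → ZMod 2)) (mA mB : Fin n → ZMod 2)
    (hm : mA ≠ 0 ∨ mB ≠ 0) :
    |∑ x : QReg n, (if (∑ i, mA i * (if x i then 1 else 0)) +
        ∑ j, mB j * e ((e.symm fun i : Fin n => if x i then 1 else 0) ^ 3) j = 0 then (1 : ℝ) else -1)|
      ≤ 2 * Real.sqrt 2 ^ n := by
  classical
  -- the two additive functionals `φ u = mA · e u`, `ψ v = mB · e v`
  let φ : K →+ ZMod 2 := AddMonoidHom.mk' (fun u => ∑ i : Fin n, mA i * e u i)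
    (fun u v => by simp only [map_add, Pi.add_apply, mul_add, Finset.sum_add_distrib])
  let ψ : K →+ ZMod 2 := AddMonoidHom.mk' (fun u => ∑ j : Fin n, mB j * e u j)
    (fun u v => by simp only [map_add, Pi.add_apply, mul_add, Finset.sum_add_distrib])
  have hφ : ∀ u, φ u = ∑ i : Fin n, mA i * e u i := fun u => rfl
  have hψ : ∀ u, ψ u = ∑ j : Fin n, mB j * e u j := fun u => rfl
  -- reindex the register by `K`
  have hbij : Function.Bijective (fun x : QReg n => e.symm fun i => if x i then (1 : ZMod 2) else 0) := by
    rw [Fintype.bijective_iff_injective_and_card]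
    refine ⟨fun x y hxy => bits_injective (e.symm.injective hxy), ?_⟩
    rw [hK, Fintype.card_fun, Fintype.card_bool, Fintype.card_fin]
  rw [Fintype.sum_bijective _ hbij _ (fun u => if φ u + ψ (u ^ 3) = 0 then (1 : ℝ) else -1) ?_]
  · by_cases hψ0 : ψ = 0
    · have hmB : mB = 0 := by
        funext j
        have h1 := DFunLike.congr_fun hψ0 (e.symm (Pi.single j 1))
        rw [hψ, AddMonoidHom.zero_apply, AddEquiv.apply_symm_apply, Finset.sum_eq_single j,
          Pi.single_eq_same, mul_one] at h1
        · exact h1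
        · intro j' _ hj'
          simp [hj']
        · simp
      have hφ0 : φ ≠ 0 := by
        intro h0
        rcases hm with h | h
        · apply h
          funext i
          have h1 := DFunLike.congr_fun h0 (e.symm (Pi.single i 1))
          rw [hφ, AddMonoidHom.zero_apply, AddEquiv.apply_symm_apply, Finset.sum_eq_single i,
            Pi.single_eq_same, mul_one] at h1
          · exact h1
          · intro i' _ hi'
            simp [hi']
          · simp
        · exact h hmB
      have hψu : ∀ u : K, ψ (u ^ 3) = 0 := fun u => by rw [hψ0, AddMonoidHom.zero_apply]
      simp_rw [hψu, add_zero]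
      rw [sum_sign_eq_zero φ hφ0, abs_zero]
      positivity
    · exact abs_walsh_cube_le hK φ ψ hψ0
  · intro x
    simp only [hφ, hψ, AddEquiv.apply_symm_apply]

/-! ### The double sum -/

/-- **Pairing by the input difference.** For kernels `A, B` on the register whose moduli are
dominated by product weights of the difference pattern, and a map `F` all of whose non-trivial
differentials are at most two-to-one,
`|Σ_{x,x'} A(x,x') B(F x, F x')| ≤ D + 2 (Σ_d w_A d) · P_B` where `D` bounds the diagonal and
`P_B ≥ Σ_t w_B t`. -/
theorem norm_double_sum_le {n : ℕ} (A B : QReg n → QReg n → ℂ) (F : QReg n → QReg n)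
    (wA wB : QReg n → ℝ) (D PB : ℝ)
    (hA : ∀ x x', ‖A x x'‖ ≤ wA (fun i => Bool.xor (x i) (x' i)))
    (hB : ∀ y y', ‖B y y'‖ ≤ wB (fun j => Bool.xor (y j) (y' j)))
    (hwA : ∀ d, 0 ≤ wA d) (hwB : ∀ t, 0 ≤ wB t)
    (hdiag : ‖∑ x, A x x * B (F x) (F x)‖ ≤ D)
    (hfib : ∀ d : QReg n, d ≠ (fun _ => false) → ∀ t : QReg n,
      (Finset.univ.filter fun x : QReg n =>
        (fun j : Fin n => Bool.xor (F x j) (F (fun i => Bool.xor (x i) (d i)) j)) = t).card ≤ 2)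
    (hPB : ∑ t, wB t ≤ PB) :
    ‖∑ x, ∑ x', A x x' * B (F x) (F x')‖ ≤ D + 2 * (∑ d, wA d) * PB := by
  classical
  have hPB0 : 0 ≤ PB := le_trans (Finset.sum_nonneg fun t _ => hwB t) hPB
  -- reindex `x' = x ⊕ d`
  have hinv : ∀ x : QReg n, Function.Involutive (fun d : QReg n => fun i => Bool.xor (x i) (d i)) := by
    intro x d
    funext i
    exact xor_xor_cancel _ _
  have hre : ∀ (x : QReg n) (f : QReg n → ℂ), ∑ x', f x' = ∑ d : QReg n, f (fun i => Bool.xor (x i) (d i)) :=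
    fun x f => (Equiv.sum_comp (Function.Involutive.toPerm _ (hinv x)) f).symm
  have hT : ∑ x, ∑ x', A x x' * B (F x) (F x') =
      ∑ d : QReg n, ∑ x, A x (fun i => Bool.xor (x i) (d i)) * B (F x) (F (fun i => Bool.xor (x i) (d i))) := by
    exact (Finset.sum_congr rfl fun x _ => hre x _).trans Finset.sum_comm
  -- one off-diagonal class
  have hO : ∀ d : QReg n, d ≠ (fun _ => false) →
      ‖∑ x, A x (fun i => Bool.xor (x i) (d i)) * B (F x) (F (fun i => Bool.xor (x i) (d i)))‖ ≤
        wA d * (2 * PB) := by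
    intro d hd
    have hG : ∑ x, wB (fun j => Bool.xor (F x j) (F (fun i => Bool.xor (x i) (d i)) j)) ≤ 2 * PB := by
      rw [← Finset.sum_fiberwise' Finset.univ
        (fun x : QReg n => fun j : Fin n => Bool.xor (F x j) (F (fun i => Bool.xor (x i) (d i)) j)) wB]
      calc ∑ t, ∑ x ∈ Finset.univ.filter (fun x : QReg n =>
              (fun j : Fin n => Bool.xor (F x j) (F (fun i => Bool.xor (x i) (d i)) j)) = t), wB t
          = ∑ t, ((Finset.univ.filter (fun x : QReg n =>
              (fun j : Fin n => Bool.xor (F x j) (F (fun i => Bool.xor (x i) (d i)) j)) = t)).card : ℝ) *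
              wB t := by
            refine Finset.sum_congr rfl fun t _ => ?_
            rw [Finset.sum_const, nsmul_eq_mul]
        _ ≤ ∑ t, 2 * wB t :=
            Finset.sum_le_sum fun t _ => mul_le_mul_of_nonneg_right (by exact_mod_cast hfib d hd t) (hwB t)
        _ = 2 * ∑ t, wB t := (Finset.mul_sum _ _ _).symm
        _ ≤ 2 * PB := by linarith
    calc ‖∑ x, A x (fun i => Bool.xor (x i) (d i)) * B (F x) (F (fun i => Bool.xor (x i) (d i)))‖
        ≤ ∑ x, ‖A x (fun i => Bool.xor (x i) (d i)) * B (F x) (F (fun i => Bool.xor (x i) (d i)))‖ :=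
          norm_sum_le _ _
      _ ≤ ∑ x, wA d * wB (fun j => Bool.xor (F x j) (F (fun i => Bool.xor (x i) (d i)) j)) := by
          refine Finset.sum_le_sum fun x _ => ?_
          rw [norm_mul]
          have hAx := hA x (fun i => Bool.xor (x i) (d i))
          simp only [xor_xor_cancel] at hAx
          exact mul_le_mul hAx (hB _ _) (norm_nonneg _) (hwA d)
      _ = wA d * ∑ x, wB (fun j => Bool.xor (F x j) (F (fun i => Bool.xor (x i) (d i)) j)) := by
          rw [Finset.mul_sum]
      _ ≤ wA d * (2 * PB) := mul_le_mul_of_nonneg_left hG (hwA d)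
  -- assemble
  rw [hT, Fintype.sum_eq_add_sum_compl (fun _ : Fin n => false)]
  simp only [Bool.xor_false]
  calc ‖∑ x, A x x * B (F x) (F x) +
        ∑ d ∈ {(fun _ : Fin n => false)}ᶜ, ∑ x, A x (fun i => Bool.xor (x i) (d i)) *
          B (F x) (F (fun i => Bool.xor (x i) (d i)))‖
      ≤ ‖∑ x, A x x * B (F x) (F x)‖ +
        ‖∑ d ∈ {(fun _ : Fin n => false)}ᶜ, ∑ x, A x (fun i => Bool.xor (x i) (d i)) *
          B (F x) (F (fun i => Bool.xor (x i) (d i)))‖ := norm_add_le _ _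
    _ ≤ D + ∑ d ∈ {(fun _ : Fin n => false)}ᶜ, wA d * (2 * PB) := by
        refine add_le_add hdiag ((norm_sum_le _ _).trans (Finset.sum_le_sum fun d hd => hO d ?_))
        simpa using hd
    _ ≤ D + ∑ d, wA d * (2 * PB) := by
        have hnn : ∀ d : QReg n, 0 ≤ wA d * (2 * PB) := fun d => mul_nonneg (hwA d) (by linarith)
        exact add_le_add le_rfl (Finset.sum_le_univ_sum_of_nonneg hnn)
    _ = D + 2 * (∑ d, wA d) * PB := by
        rw [← Finset.sum_mul]
        ring

end OneSided

/-- **Registered sub-goal `stub_oneSidedPairing`** (file 1/2 of stub `stub_oneSidedFlat`): the pairing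
estimate `|Σ_{x,x'} A(x,x') B(Fx,Fx')| ≤ D + 2 (Σ_d w_A d) · P_B` for kernels dominated by product
weights of the difference pattern and a map `F` whose non-trivial differentials are at most two-to-one
(`OneSided.norm_double_sum_le`). -/
theorem stub_oneSidedPairing : ∀ {n : ℕ} (A B : QReg n → QReg n → ℂ) (F : QReg n → QReg n) (wA wB : QReg n → ℝ) (D PB : ℝ), (∀ x x', ‖A x x'‖ ≤ wA (fun i => Bool.xor (x i) (x' i))) → (∀ y y', ‖B y y'‖ ≤ wB (fun j => Bool.xor (y j) (y' j))) → (∀ d, 0 ≤ wA d) → (∀ t, 0 ≤ wB t) → ‖∑ x, A x x * B (F x) (F x)‖ ≤ D → (∀ d : QReg n, d ≠ (fun _ => false) → ∀ t : QReg n, (Finset.univ.filter fun x : QReg n => (fun j : Fin n => Bool.xor (F x j) (F (fun i => Bool.xor (x i) (d i)) j)) = t).card ≤ 2) → ∑ t, wB t ≤ PB → ‖∑ x, ∑ x', A x x' * B (F x) (F x')‖ ≤ D + 2 * (∑ d, wA d) * PB :=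
  fun A B F wA wB D PB hA hB hwA hwB hdiag hfib hPB =>
    OneSided.norm_double_sum_le A B F wA wB D PB hA hB hwA hwB hdiag hfib hPB

end Summit.QuantumAdvantage.QuantumAdvantage.Theorems.SymplecticPurity
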